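import Summits.QuantumAdvantage.QuantumAdvantage.Theorems.SosSandwichTransferPBLogScale
import Summits.QuantumAdvantage.QuantumAdvantage.Theorems.SosSandwichTransferPBPathBoundChainFinal
import HarnessLib

/-!
# `TransferPB`'s machine reduction per family AT THE MACHINE'S OWN SCALE, part 2 (levels 5–9, the log-query scale bound, the machine-level theorem) — the UNCONDITIONAL log-query transfer

Route `SosSandwich`; support for `RandomOracleHeurSeparation` (stmt-QuantumAdvantage-1131) and the analytic crux (stmt-15237);
target: RandomOracleGauge's support item `LogQueryTransfer` (stmt-QuantumAdvantage-1155) — Aaronson–Ambainis Thm. 26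
(`BQP^{A[log]} ⊆ AvgP^A` a.s.) in the promise-transfer form, with NO influence conjecture.  The per-family chain
(`…TransferPBPerFamily*.lean`) still asks for an influence bound `C₀ (ε/d)^c` at EVERY scale `ε`, which the proved DFKO bound
(`2^{-O(d)}` loss) cannot supply once `d ~ log n`.  But the root machine only uses the bound at ITS OWN scale
`ε = θ/2 = 1/(400 (r(n)+1))`, which is `1/poly(n)` once the error polynomial is bumped (`r' = r + X`): there the slack `ε^{c-a}`
absorbs `2^{O(log n)} = poly(n)`.  So this file re-states the nine levels (proofs verbatim twins; root: `intro F` dropped, the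
machine instantiated at the bumped `r'`, final bound `1/(r'(n)+1) ≤ 1/(r(n)+1)`) with the hypothesis

  `ScaleBound F₀ := ∀ r, ∃ r' c k, r ≤ r' ∧ ∀ x (|x| ≥ 1) ρ, θ'_x/2 < Var[p_x|_ρ] → ∃ i, 2^{-k} ((θ'_x/2)/thm23Degree F₀ x)^c ≤ Inf_i`,
  `θ'_x = (1/10)² · (1/(r'(|x|)+1)) / 2` (written out inline),

and the sequel proves `ScaleBound F₀` UNCONDITIONALLY for every uniform family with `≤ c'·log₂ n + c'` oracle gates.
Honest label: re-threading + one new arithmetic lemma; nothing new about machines.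
Sources: AaronsonAmbainis2014 Thm. 21, 23 (proof p. 14), 26; DinurEtAl2007 Thm. 3; Zhandry2012; BBBV1997.
-/

-- D-0017: single-conjunct summit ⇒ the duplicate `QuantumAdvantage.QuantumAdvantage` is mandated.
set_option linter.dupNamespace false

noncomputable section

namespace Summit.QuantumAdvantage.QuantumAdvantage.Cruxes.TransferPB.Birth

open Finset MeasureTheory Literature.Computability.Cryptography Literature.Computability.Complexity
  Literature.Computability.QuantumComplexity Literature.Computability.QuantumComplexity.ClassicalSimulation
open Summit.QuantumAdvantage.QuantumAdvantage.Theses.SosSandwich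
open scoped ENNReal

namespace SimTreePB
/-- **Node-problem level, path-wise bound** (twin of `stub_pbOracleSimulation_of_nodeProblem_consistent`, per-family form, proof verbatim). [cite: AaronsonAmbainis2014, Thm. 23 (proof, p. 14)] -/
theorem oracleSimulationSc_of_nodeProblem_consistent_path (F₀ : QCircuitFamily cliffordT)
    (hQ : ∀ (c k : ℕ) (F : QCircuitFamily cliffordT), F.IsUniform → ∀ r : Polynomial ℕ,
      nodeProblem F r c k ∈ Literature.Computability.Cryptography.PromiseBQP)
    (hM : ∀ (c k : ℕ) (F : QCircuitFamily cliffordT), F.IsUniform → ∀ r : Polynomial ℕ,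
      ∃ (C : OracleAlg Bool) (q : Polynomial ℕ),
        C.IsPolyTime Computability.encodingBoolBool ∧
        (∀ (O : Oracle) (x : List Bool), ∀ y ∈ C.queries O (q.eval x.length) x, y.length ≤ q.eval x.length) ∧
        ∀ x : List Bool, 1 ≤ x.length → ∀ g : List Bool → Bool,
          (∀ v ∈ (nodeProblem F r c k).yes, g v = true) → (∀ v ∈ (nodeProblem F r c k).no, g v = false) →
          ∃ D : ℕ, machineBudget F x r c k ≤ D ∧
            ∀ A : Set (List Bool),
              C.run (Oracle.ofLanguage {w : List Bool | ∃ v : List Bool,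
                  (w = false :: v ∧ v ∈ A) ∨ (w = true :: v ∧ g v = true)}) (q.eval x.length) x =
                some (decide (1 / 2 ≤
                  (advTree (derivedAdvisor F x g) D []).eval (oracleBits F x A)))) :
    (∀ r : Polynomial ℕ, ∃ (r' : Polynomial ℕ) (c k : ℕ), (∀ n, r.eval n ≤ r'.eval n) ∧
      ∀ (x : List Bool), 1 ≤ x.length → ∀ ρ : List (Fin (numOracleBits F₀ x) × Bool),
        ((1 / 10 : ℝ) ^ 2 * (1 / (((r'.eval x.length : ℕ) : ℝ) + 1)) / 2) / 2 <
            boolVariance (restrictPath ρ (acceptPoly F₀ x)) →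
          ∃ i : Fin (numOracleBits F₀ x),
            (1 / 2 ^ k : ℝ) * ((((1 / 10 : ℝ) ^ 2 * (1 / (((r'.eval x.length : ℕ) : ℝ) + 1)) / 2) / 2) /
              thm23Degree F₀ x) ^ c ≤ influence i (restrictPath ρ (acceptPoly F₀ x))) →
      F₀.IsUniform → ∀ r : Polynomial ℕ,
        ∃ Q ∈ Literature.Computability.Cryptography.PromiseBQP, ∃ (C : OracleAlg Bool) (q : Polynomial ℕ),
          C.IsPolyTime Computability.encodingBoolBool ∧
          (∀ (O : Oracle) (x : List Bool), ∀ y ∈ C.queries O (q.eval x.length) x, y.length ≤ q.eval x.length) ∧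
          ∀ x : List Bool, 1 ≤ x.length → ∀ g : List Bool → Bool,
            (∀ v ∈ Q.yes, g v = true) → (∀ v ∈ Q.no, g v = false) →
            (ProbabilityTheory.setBernoulli (Set.univ : Set (List Bool)) ⟨1 / 2, by norm_num, by norm_num⟩)
              {A : Set (List Bool) |
                (2 / 3 ≤ F₀.acceptProbOn A x ∧
                  C.run (Oracle.ofLanguage {w : List Bool | ∃ v : List Bool, (w = false :: v ∧ v ∈ A) ∨
                    (w = true :: v ∧ g v = true)}) (q.eval x.length) x ≠ some true) ∨
                (F₀.acceptProbOn A x ≤ 1 / 3 ∧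
                  C.run (Oracle.ofLanguage {w : List Bool | ∃ v : List Bool, (w = false :: v ∧ v ∈ A) ∨
                    (w = true :: v ∧ g v = true)}) (q.eval x.length) x ≠ some false)}
              ≤ ENNReal.ofReal (1 / (((r.eval x.length : ℕ) : ℝ) + 1)) := by
  refine oracleSimulationSc_of_keptMachines_path F₀ hQ fun c k F hF r => ?_
  obtain ⟨C, q, hCpoly, hCq, hrun⟩ := hM c k F hF r
  refine ⟨C, q, hCpoly, hCq, fun x hx g hgy hgn => ?_⟩
  obtain ⟨D, hD, hrunA⟩ := hrun x hx g hgy hgn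
  exact ⟨derivedAdvisor F x g, D, hD, fun ρ s h => derivedAdvisor_pick_some_kept h,
    fun ρ h => derivedAdvisor_pick_none_kept h, derivedAdvisor_val_eq, hrunA⟩



/-- **Descent-machine level, path-wise bound** (twin of `stub_pbOracleSimulation_of_descentMachines`, per-family form, proof verbatim). [cite: AaronsonAmbainis2014, Thm. 23 (proof, p. 14)] -/
theorem oracleSimulationSc_of_descentMachines_path (F₀ : QCircuitFamily cliffordT)
    (hQ : ∀ (c k : ℕ) (F : QCircuitFamily cliffordT), F.IsUniform → ∀ r : Polynomial ℕ,
      nodeProblem F r c k ∈ Literature.Computability.Cryptography.PromiseBQP)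
    (hM : ∀ (c k : ℕ) (F : QCircuitFamily cliffordT), F.IsUniform → ∀ r : Polynomial ℕ,
      ∃ (C : OracleAlg Bool) (q : Polynomial ℕ),
        C.IsPolyTime Computability.encodingBoolBool ∧
        (∀ (O : Oracle) (x : List Bool), ∀ y ∈ C.queries O (q.eval x.length) x, y.length ≤ q.eval x.length) ∧
        ∀ x : List Bool, 1 ≤ x.length → ∀ g : List Bool → Bool,
          (∀ v ∈ (nodeProblem F r c k).yes, g v = true) → (∀ v ∈ (nodeProblem F r c k).no, g v = false) →
          ∃ D : ℕ, machineBudget F x r c k ≤ D ∧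
            ∀ A : Set (List Bool),
              C.run (Oracle.ofLanguage {w : List Bool | ∃ v : List Bool,
                  (w = false :: v ∧ v ∈ A) ∨ (w = true :: v ∧ g v = true)}) (q.eval x.length) x =
                some (decide (1 / 2 ≤
                  (advTree (descentAdvisor F x g) D []).eval (oracleBits F x A)))) :
    (∀ r : Polynomial ℕ, ∃ (r' : Polynomial ℕ) (c k : ℕ), (∀ n, r.eval n ≤ r'.eval n) ∧
      ∀ (x : List Bool), 1 ≤ x.length → ∀ ρ : List (Fin (numOracleBits F₀ x) × Bool),
        ((1 / 10 : ℝ) ^ 2 * (1 / (((r'.eval x.length : ℕ) : ℝ) + 1)) / 2) / 2 <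
            boolVariance (restrictPath ρ (acceptPoly F₀ x)) →
          ∃ i : Fin (numOracleBits F₀ x),
            (1 / 2 ^ k : ℝ) * ((((1 / 10 : ℝ) ^ 2 * (1 / (((r'.eval x.length : ℕ) : ℝ) + 1)) / 2) / 2) /
              thm23Degree F₀ x) ^ c ≤ influence i (restrictPath ρ (acceptPoly F₀ x))) →
      F₀.IsUniform → ∀ r : Polynomial ℕ,
        ∃ Q ∈ Literature.Computability.Cryptography.PromiseBQP, ∃ (C : OracleAlg Bool) (q : Polynomial ℕ),
          C.IsPolyTime Computability.encodingBoolBool ∧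
          (∀ (O : Oracle) (x : List Bool), ∀ y ∈ C.queries O (q.eval x.length) x, y.length ≤ q.eval x.length) ∧
          ∀ x : List Bool, 1 ≤ x.length → ∀ g : List Bool → Bool,
            (∀ v ∈ Q.yes, g v = true) → (∀ v ∈ Q.no, g v = false) →
            (ProbabilityTheory.setBernoulli (Set.univ : Set (List Bool)) ⟨1 / 2, by norm_num, by norm_num⟩)
              {A : Set (List Bool) |
                (2 / 3 ≤ F₀.acceptProbOn A x ∧
                  C.run (Oracle.ofLanguage {w : List Bool | ∃ v : List Bool, (w = false :: v ∧ v ∈ A) ∨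
                    (w = true :: v ∧ g v = true)}) (q.eval x.length) x ≠ some true) ∨
                (F₀.acceptProbOn A x ≤ 1 / 3 ∧
                  C.run (Oracle.ofLanguage {w : List Bool | ∃ v : List Bool, (w = false :: v ∧ v ∈ A) ∨
                    (w = true :: v ∧ g v = true)}) (q.eval x.length) x ≠ some false)}
              ≤ ENNReal.ofReal (1 / (((r.eval x.length : ℕ) : ℝ) + 1)) := by
  refine oracleSimulationSc_of_keptMachines_path F₀ hQ fun c k F hF r => ?_
  obtain ⟨C, q, hCpoly, hCq, hrun⟩ := hM c k F hF r
  refine ⟨C, q, hCpoly, hCq, fun x hx g hgy hgn => ?_⟩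
  obtain ⟨D, hD, hrunA⟩ := hrun x hx g hgy hgn
  exact ⟨descentAdvisor F x g, D, hD, fun ρ s h => descentAdvisor_pick_some h,
    fun ρ h => descentAdvisor_pick_none h, descentAdvisor_val_eq, hrunA⟩

/-- **String-machine level, path-wise bound** (twin of `stub_pbOracleSimulation_of_stringMachines`, per-family form, proof verbatim). [cite: AaronsonAmbainis2014, Thm. 23 (proof, p. 14)] -/
theorem oracleSimulationSc_of_stringMachines_path (F₀ : QCircuitFamily cliffordT)
    (hQ : ∀ (c k : ℕ) (F : QCircuitFamily cliffordT), F.IsUniform → ∀ r : Polynomial ℕ,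
      nodeProblem F r c k ∈ Literature.Computability.Cryptography.PromiseBQP)
    (hM : ∀ (c k : ℕ) (F : QCircuitFamily cliffordT), F.IsUniform → ∀ r : Polynomial ℕ,
      ∃ (C : OracleAlg Bool) (q : Polynomial ℕ),
        C.IsPolyTime Computability.encodingBoolBool ∧
        (∀ (O : Oracle) (x : List Bool), ∀ y ∈ C.queries O (q.eval x.length) x, y.length ≤ q.eval x.length) ∧
        ∀ x : List Bool, 1 ≤ x.length → ∀ g : List Bool → Bool,
          (∀ v ∈ (nodeProblem F r c k).yes, g v = true) → (∀ v ∈ (nodeProblem F r c k).no, g v = false) →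
          ∃ (W' D : ℕ), oracleWidth F x ≤ W' ∧ machineBudget F x r c k ≤ D ∧
            ∀ A : Set (List Bool),
              C.run (Oracle.ofLanguage {w : List Bool | ∃ v : List Bool,
                  (w = false :: v ∧ v ∈ A) ∨ (w = true :: v ∧ g v = true)}) (q.eval x.length) x =
                some (decide (20 ≤ meanCount g x (strWalk g x W' (fun u => A.boolIndicator u) D [])))) :
    (∀ r : Polynomial ℕ, ∃ (r' : Polynomial ℕ) (c k : ℕ), (∀ n, r.eval n ≤ r'.eval n) ∧
      ∀ (x : List Bool), 1 ≤ x.length → ∀ ρ : List (Fin (numOracleBits F₀ x) × Bool),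
        ((1 / 10 : ℝ) ^ 2 * (1 / (((r'.eval x.length : ℕ) : ℝ) + 1)) / 2) / 2 <
            boolVariance (restrictPath ρ (acceptPoly F₀ x)) →
          ∃ i : Fin (numOracleBits F₀ x),
            (1 / 2 ^ k : ℝ) * ((((1 / 10 : ℝ) ^ 2 * (1 / (((r'.eval x.length : ℕ) : ℝ) + 1)) / 2) / 2) /
              thm23Degree F₀ x) ^ c ≤ influence i (restrictPath ρ (acceptPoly F₀ x))) →
      F₀.IsUniform → ∀ r : Polynomial ℕ,
        ∃ Q ∈ Literature.Computability.Cryptography.PromiseBQP, ∃ (C : OracleAlg Bool) (q : Polynomial ℕ),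
          C.IsPolyTime Computability.encodingBoolBool ∧
          (∀ (O : Oracle) (x : List Bool), ∀ y ∈ C.queries O (q.eval x.length) x, y.length ≤ q.eval x.length) ∧
          ∀ x : List Bool, 1 ≤ x.length → ∀ g : List Bool → Bool,
            (∀ v ∈ Q.yes, g v = true) → (∀ v ∈ Q.no, g v = false) →
            (ProbabilityTheory.setBernoulli (Set.univ : Set (List Bool)) ⟨1 / 2, by norm_num, by norm_num⟩)
              {A : Set (List Bool) |
                (2 / 3 ≤ F₀.acceptProbOn A x ∧
                  C.run (Oracle.ofLanguage {w : List Bool | ∃ v : List Bool, (w = false :: v ∧ v ∈ A) ∨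
                    (w = true :: v ∧ g v = true)}) (q.eval x.length) x ≠ some true) ∨
                (F₀.acceptProbOn A x ≤ 1 / 3 ∧
                  C.run (Oracle.ofLanguage {w : List Bool | ∃ v : List Bool, (w = false :: v ∧ v ∈ A) ∨
                    (w = true :: v ∧ g v = true)}) (q.eval x.length) x ≠ some false)}
              ≤ ENNReal.ofReal (1 / (((r.eval x.length : ℕ) : ℝ) + 1)) := by
  refine oracleSimulationSc_of_descentMachines_path F₀ hQ fun c k F hF r => ?_
  obtain ⟨C, q, hCpoly, hCq, hrun⟩ := hM c k F hF r
  refine ⟨C, q, hCpoly, hCq, fun x hx g hgy hgn => ?_⟩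
  obtain ⟨W', D, hW, hD, hrunA⟩ := hrun x hx g hgy hgn
  refine ⟨D, hD, fun A => ?_⟩
  rw [hrunA A, decide_eval_advTree_descentAdvisor, ← strPath_nil F x,
    strWalk_eq_of_le hgn (fun u => A.boolIndicator u) hW D []]

/-- **Event-machine level, path-wise bound** (twin of `stub_pbOracleSimulation_of_eventOSM`, per-family form, proof verbatim). [cite: AaronsonAmbainis2014, Thm. 23 (proof, p. 14)] -/
theorem oracleSimulationSc_of_eventOSM_path (F₀ : QCircuitFamily cliffordT)
    (hQ : ∀ (c k : ℕ) (F : QCircuitFamily cliffordT), F.IsUniform → ∀ r : Polynomial ℕ,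
      nodeProblem F r c k ∈ Literature.Computability.Cryptography.PromiseBQP)
    (hE : ∀ pw pd : Polynomial ℕ, ∃ (S : OSM) (enc : List Bool → EvState → List Bool) (G : Polynomial ℕ),
      S.ini ∈ FP ∧ S.del ∈ FP ∧ S.kap ∈ FP ∧
      (∀ (x st : List Bool) (b : Bool), (S.del (boolPair x (boolPair st [b]))).length ≤ st.length + G.eval x.length) ∧
      (∀ x : List Bool, S.ini x = enc x (evInit (pd.eval x.length))) ∧
      (∀ (x : List Bool) (s : EvState) (b : Bool), EvInv (pw.eval x.length) (pd.eval x.length) s →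
        S.del (boolPair x (boolPair (enc x s) [b])) = enc x (evDelta (pw.eval x.length) s b)) ∧
      (∀ (x : List Bool) (s : EvState), EvInv (pw.eval x.length) (pd.eval x.length) s →
        S.kap (boolPair x (enc x s)) = Sum.elim (fun q => false :: q) (fun b => [true, b]) (evKappa x s))) :
    (∀ r : Polynomial ℕ, ∃ (r' : Polynomial ℕ) (c k : ℕ), (∀ n, r.eval n ≤ r'.eval n) ∧
      ∀ (x : List Bool), 1 ≤ x.length → ∀ ρ : List (Fin (numOracleBits F₀ x) × Bool),
        ((1 / 10 : ℝ) ^ 2 * (1 / (((r'.eval x.length : ℕ) : ℝ) + 1)) / 2) / 2 <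
            boolVariance (restrictPath ρ (acceptPoly F₀ x)) →
          ∃ i : Fin (numOracleBits F₀ x),
            (1 / 2 ^ k : ℝ) * ((((1 / 10 : ℝ) ^ 2 * (1 / (((r'.eval x.length : ℕ) : ℝ) + 1)) / 2) / 2) /
              thm23Degree F₀ x) ^ c ≤ influence i (restrictPath ρ (acceptPoly F₀ x))) →
      F₀.IsUniform → ∀ r : Polynomial ℕ,
        ∃ Q ∈ Literature.Computability.Cryptography.PromiseBQP, ∃ (C : OracleAlg Bool) (q : Polynomial ℕ),
          C.IsPolyTime Computability.encodingBoolBool ∧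
          (∀ (O : Oracle) (x : List Bool), ∀ y ∈ C.queries O (q.eval x.length) x, y.length ≤ q.eval x.length) ∧
          ∀ x : List Bool, 1 ≤ x.length → ∀ g : List Bool → Bool,
            (∀ v ∈ Q.yes, g v = true) → (∀ v ∈ Q.no, g v = false) →
            (ProbabilityTheory.setBernoulli (Set.univ : Set (List Bool)) ⟨1 / 2, by norm_num, by norm_num⟩)
              {A : Set (List Bool) |
                (2 / 3 ≤ F₀.acceptProbOn A x ∧
                  C.run (Oracle.ofLanguage {w : List Bool | ∃ v : List Bool, (w = false :: v ∧ v ∈ A) ∨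
                    (w = true :: v ∧ g v = true)}) (q.eval x.length) x ≠ some true) ∨
                (F₀.acceptProbOn A x ≤ 1 / 3 ∧
                  C.run (Oracle.ofLanguage {w : List Bool | ∃ v : List Bool, (w = false :: v ∧ v ∈ A) ∨
                    (w = true :: v ∧ g v = true)}) (q.eval x.length) x ≠ some false)}
              ≤ ENNReal.ofReal (1 / (((r.eval x.length : ℕ) : ℝ) + 1)) := by
  refine oracleSimulationSc_of_stringMachines_path F₀ hQ fun c k F hF r => ?_
  obtain ⟨s, hs⟩ := QCircuitFamily.IsUniform.isPolySize' hF
  let Lp : Polynomial ℕ :=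
    Polynomial.C 8 * s ^ 2 * Polynomial.C (2 ^ k) * (Polynomial.C 400 * (Polynomial.C 2 * s + 1) * (r + 1)) ^ c
  let pw : Polynomial ℕ := Polynomial.X + s
  let pd : Polynomial ℕ := Polynomial.C 2 * Lp * (r + 1) + 1
  have hLp : ∀ n : ℕ, Lp.eval n = 8 * (s.eval n) ^ 2 * 2 ^ k * (400 * (2 * s.eval n + 1) * (r.eval n + 1)) ^ c := by
    intro n; simp [Lp]
  have hpw : ∀ n : ℕ, pw.eval n = n + s.eval n := by intro n; simp [pw]
  have hpd : ∀ n : ℕ, pd.eval n = 2 * Lp.eval n * (r.eval n + 1) + 1 := by intro n; simp [pd]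
  obtain ⟨S, enc, G, hiniFP, hdelFP, hkapFP, hG, hini, hdel, hkap⟩ := hE pw pd
  let q : Polynomial ℕ :=
    pd * (Polynomial.C 3 * (pw * Lp) + Polynomial.C 2) + Polynomial.C 41 +
      (Polynomial.C 2 * Polynomial.X + Polynomial.C 2 * pd * (Polynomial.C 2 * pw + Polynomial.C 4) + pw + Polynomial.C 50)
  have hq : ∀ n : ℕ, q.eval n = pd.eval n * (3 * (pw.eval n * Lp.eval n) + 2) + 41 +
      (2 * n + 2 * pd.eval n * (2 * pw.eval n + 4) + pw.eval n + 50) := by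
    intro n; simp [q]
  refine ⟨S.alg.mapOut Computability.decodeBool, q,
    isPolyTime_mapOut_decodeBool (S.isPolyTime_alg hiniFP hdelFP hkapFP hG), fun O x y hy => ?_,
    fun x _ g _ hgn => ?_⟩
  · -- query lengths
    have h := length_le_of_mem_queries_osm_mapOut (hini x) (hdel x) (hkap x) O _ hy
    unfold evQueryBound at h
    rw [hq]
    omega
  · -- runs within the round budget
    have hW : oracleWidth F x ≤ pw.eval x.length := by
      show x.length + F.ancillas x.length ≤ pw.eval x.length
      rw [hpw]
      exact Nat.add_le_add_left (hs x.length).2 _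
    have hT : (F.circ x.length).oracleQueries ≤ s.eval x.length :=
      (QCircuit.oracleQueries_le_size _).trans (hs x.length).1
    have hBL : 8 * (F.circ x.length).oracleQueries ^ 2 * 2 ^ k * (400 * thm23Degree F x * (r.eval x.length + 1)) ^ c ≤
        Lp.eval x.length := by
      rw [hLp]; exact liveBoundNat_mono (r := r) (c := c) (k := k) hT
    have hD : machineBudget F x r c k ≤ pd.eval x.length := by
      rw [machineBudget_eq_nat, hpd]
      gcongr
    refine ⟨pw.eval x.length, pd.eval x.length, hW, hD, fun A => ?_⟩
    rw [run_osm_mapOut (hini x) (hdel x) (hkap x)]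
    obtain ⟨m, hm, hrun⟩ := evLoop_evInit x (pw.eval x.length)
      (O := fun q' => Set.boolIndicator {w : List Bool | ∃ v : List Bool,
        (w = false :: v ∧ v ∈ A) ∨ (w = true :: v ∧ g v = true)} q')
      (g := g) (inA := fun u => A.boolIndicator u)
      (boolIndicator_combined_true A g) (boolIndicator_combined_false A g)
      (fun π => ∃ ρ : List (Fin (numOracleBits F x) × Bool), π = strPath F x ρ) ⟨[], (strPath_nil F x).symm⟩
      (fun π hπ j => by obtain ⟨ρ, rfl⟩ := hπ; exact length_liveLevel_strPath_le hgn ρ j)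
      (fun π hπ u hu => by
        obtain ⟨ρ, rfl⟩ := hπ
        obtain ⟨ρ', h⟩ := strPath_step_descentPick hgn hW ρ hu (A.boolIndicator u)
        exact ⟨ρ', h⟩) (pd.eval x.length)
    refine hrun _ (hm.trans ?_)
    have h2 : pd.eval x.length * (3 * (pw.eval x.length * (8 * (F.circ x.length).oracleQueries ^ 2 * 2 ^ k *
        (400 * thm23Degree F x * (r.eval x.length + 1)) ^ c)) + 2) ≤
        pd.eval x.length * (3 * (pw.eval x.length * Lp.eval x.length) + 2) := by
      gcongr
    rw [hq]
    omega

/-- **The event-driven chain, path-wise bound** (twin of `EvOSM.stub_pbOracleSimulation_of_Q`): `OracleSimulation` from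
(Q) `nodeProblem ∈ PromiseBQP` and `AApath`. [cite: AaronsonAmbainis2014, Thm. 23 (proof, p. 14)] -/
theorem oracleSimulationSc_of_Q_path (F₀ : QCircuitFamily cliffordT)
    (hQ : ∀ (c k : ℕ) (F : QCircuitFamily cliffordT), F.IsUniform → ∀ r : Polynomial ℕ,
      nodeProblem F r c k ∈ Literature.Computability.Cryptography.PromiseBQP) :
    (∀ r : Polynomial ℕ, ∃ (r' : Polynomial ℕ) (c k : ℕ), (∀ n, r.eval n ≤ r'.eval n) ∧
      ∀ (x : List Bool), 1 ≤ x.length → ∀ ρ : List (Fin (numOracleBits F₀ x) × Bool),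
        ((1 / 10 : ℝ) ^ 2 * (1 / (((r'.eval x.length : ℕ) : ℝ) + 1)) / 2) / 2 <
            boolVariance (restrictPath ρ (acceptPoly F₀ x)) →
          ∃ i : Fin (numOracleBits F₀ x),
            (1 / 2 ^ k : ℝ) * ((((1 / 10 : ℝ) ^ 2 * (1 / (((r'.eval x.length : ℕ) : ℝ) + 1)) / 2) / 2) /
              thm23Degree F₀ x) ^ c ≤ influence i (restrictPath ρ (acceptPoly F₀ x))) →
      F₀.IsUniform → ∀ r : Polynomial ℕ,
        ∃ Q ∈ Literature.Computability.Cryptography.PromiseBQP, ∃ (C : OracleAlg Bool) (q : Polynomial ℕ),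
          C.IsPolyTime Computability.encodingBoolBool ∧
          (∀ (O : Oracle) (x : List Bool), ∀ y ∈ C.queries O (q.eval x.length) x, y.length ≤ q.eval x.length) ∧
          ∀ x : List Bool, 1 ≤ x.length → ∀ g : List Bool → Bool,
            (∀ v ∈ Q.yes, g v = true) → (∀ v ∈ Q.no, g v = false) →
            (ProbabilityTheory.setBernoulli (Set.univ : Set (List Bool)) ⟨1 / 2, by norm_num, by norm_num⟩)
              {A : Set (List Bool) |
                (2 / 3 ≤ F₀.acceptProbOn A x ∧
                  C.run (Oracle.ofLanguage {w : List Bool | ∃ v : List Bool, (w = false :: v ∧ v ∈ A) ∨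
                    (w = true :: v ∧ g v = true)}) (q.eval x.length) x ≠ some true) ∨
                (F₀.acceptProbOn A x ≤ 1 / 3 ∧
                  C.run (Oracle.ofLanguage {w : List Bool | ∃ v : List Bool, (w = false :: v ∧ v ∈ A) ∨
                    (w = true :: v ∧ g v = true)}) (q.eval x.length) x ≠ some false)}
              ≤ ENNReal.ofReal (1 / (((r.eval x.length : ℕ) : ℝ) + 1)) :=
  oracleSimulationSc_of_eventOSM_path F₀ hQ EvOSM.eventOSM_spec


/-! ### Consequences at machine scale -/

/-- **Promise-oracle simulation of ONE uniform family from the influence bound AT THE MACHINE'S OWN SCALE** (machine halves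
discharged in the tree). [cite: AaronsonAmbainis2014, Thm. 23 (proof, p. 14)] -/
theorem oracleSimulationSc_of_scaleBound (F₀ : QCircuitFamily cliffordT)
    (hAA : ∀ r : Polynomial ℕ, ∃ (r' : Polynomial ℕ) (c k : ℕ), (∀ n, r.eval n ≤ r'.eval n) ∧
      ∀ (x : List Bool), 1 ≤ x.length → ∀ ρ : List (Fin (numOracleBits F₀ x) × Bool),
        ((1 / 10 : ℝ) ^ 2 * (1 / (((r'.eval x.length : ℕ) : ℝ) + 1)) / 2) / 2 <
            boolVariance (restrictPath ρ (acceptPoly F₀ x)) →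
          ∃ i : Fin (numOracleBits F₀ x),
            (1 / 2 ^ k : ℝ) * ((((1 / 10 : ℝ) ^ 2 * (1 / (((r'.eval x.length : ℕ) : ℝ) + 1)) / 2) / 2) /
              thm23Degree F₀ x) ^ c ≤ influence i (restrictPath ρ (acceptPoly F₀ x))) :
    F₀.IsUniform → ∀ r : Polynomial ℕ,
        ∃ Q ∈ Literature.Computability.Cryptography.PromiseBQP, ∃ (C : OracleAlg Bool) (q : Polynomial ℕ),
          C.IsPolyTime Computability.encodingBoolBool ∧
          (∀ (O : Oracle) (x : List Bool), ∀ y ∈ C.queries O (q.eval x.length) x, y.length ≤ q.eval x.length) ∧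
          ∀ x : List Bool, 1 ≤ x.length → ∀ g : List Bool → Bool,
            (∀ v ∈ Q.yes, g v = true) → (∀ v ∈ Q.no, g v = false) →
            (ProbabilityTheory.setBernoulli (Set.univ : Set (List Bool)) ⟨1 / 2, by norm_num, by norm_num⟩)
              {A : Set (List Bool) |
                (2 / 3 ≤ F₀.acceptProbOn A x ∧
                  C.run (Oracle.ofLanguage {w : List Bool | ∃ v : List Bool, (w = false :: v ∧ v ∈ A) ∨
                    (w = true :: v ∧ g v = true)}) (q.eval x.length) x ≠ some true) ∨
                (F₀.acceptProbOn A x ≤ 1 / 3 ∧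
                  C.run (Oracle.ofLanguage {w : List Bool | ∃ v : List Bool, (w = false :: v ∧ v ∈ A) ∨
                    (w = true :: v ∧ g v = true)}) (q.eval x.length) x ≠ some false)}
              ≤ ENNReal.ofReal (1 / (((r.eval x.length : ℕ) : ℝ) + 1)) :=
  oracleSimulationSc_of_Q_path F₀ (fun c k _ hF r => nodeProblem_mem_PromiseBQP r c k hF) hAA


end SimTreePB

end Summit.QuantumAdvantage.QuantumAdvantage.Cruxes.TransferPB.Birth

end
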